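import Literature.AlgebraicGeometry.HodgeTheory.WeightedPencilMonodromyMap
import Literature.AlgebraicGeometry.HodgeTheory.WeightedPencilLocalFibre
import Mathlib.Topology.Homotopy.Basic
import Mathlib.Topology.Homeomorph.Lemmas
import HarnessLib

/-!
# The localisation datum of the geometric monodromy of a pencil member near an isolated singular point of Pham–Brieskorn
# type (arbitrary weights): the inverse time-one map is the identity off the chart ball and homotopy-conjugate to the
# inverse weighted rotation inside it

Family `hodge`, layer `Literature/AlgebraicGeometry/HodgeTheory`; theorems only (no definition, no named fact). Written by the
prover seat `hodge-nonav-20241-p1` (g19, cell `hodge-nonav`) as brick 6 of the port B4c of the programme «A₃-TRACE» (memo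
`HOME/memos/PROGRAMME-A3-TRACE-Bx-g16.md` §3; binder hN `stub_a3NonComm` of crux K1-B `VeryGeneralSignCommutatorsInHg`,
stmt-HodgeConjecture-19716): the WEIGHTED twin of prover-Bx's `NodalPencilLocalisation` (all weights `2`, model monodromy = the antipodal
map). Fix a weight vector `a` (all `aⱼ ≠ 0`), a chart `Θ` with `Σⱼ (Θ y)ⱼ^{aⱼ} = φ(y)`, a member `X_c = NodalPencil.pencilFibre n d i b₀ c`
(`0 < |c| < δ₀`), COMPACT, and let `h₁, k₁ : S → S` be the time-one geometric monodromy map and its inverse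
(`WeightedPencilMonodromyMap.exists_pencil_monodromyMap` at `u = 1`) with the homotopy `H` from the model monodromy `J(2π, ·)` — the
WEIGHTED ROTATION `R_{2π} : zⱼ ↦ e^{2πi/aⱼ} zⱼ` of the chart coordinates (Milnor §9 Lemma 9.4) — to `h₁` on the chart ball. Then
(`exists_localisation_pencilFibre`), with `A = X_c ∩ {F < T'}`, `B = X_c ∩ {F > t₂}` (`t₂ < T' < T`):

* the inverse `κ = k₁|_{X_c}` is a CONTINUOUS self-map of `X_c` (the inverse of the homeomorphism `h₁|_{X_c}` of the compact Hausdorff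
  space `X_c`), the identity on `B`, preserving `A` (restriction `κA`);
* the local Milnor fibre chart `e : A → F_a = {Σ zⱼ^{aⱼ} = 1}` of `WeightedPencilLocalFibre` (bijective on every `H_k(·; M)`) conjugates
  `κA` up to homotopy to the INVERSE ROTATION `g = R_{−2π} : zⱼ ↦ e^{−2πi/aⱼ} zⱼ` of the fibre: first `e ∘ h₁|_A ≃ R_{2π} ∘ e` by the
  homotopy `e ∘ H(s, ·)`, then `e ∘ κA ≃ R_{−2π} ∘ e` formally from `h₁ ∘ κA = id` and `R_{−2π} ∘ R_{2π} = id`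
  (`exists_weightedRotation_fibre`). At a node (`a = 2`) both rotations are the antipodal map; at an `A₃` point (`a = (2, …, 2, 4)`)
  `g = (−z₀, …, −z_{n−1}, −i·zₙ)`, `g⁴ = id`, `g ∘ g = ` the rotation of the last coordinate by `−1`.

Everything is proved; no definitions, no named facts. Honest scope: plumbing of the classical construction of the geometric monodromy of
a pencil near an isolated weighted-homogeneous singular point; nothing here says HC or any rung is proved.

## References

* [ArnoldGuseinzadeVarchenko2012] V. I. Arnold, S. M. Gusein-Zade, A. N. Varchenko, Singularities of Differentiable Maps II (2012),
  Part I §1.1, §1.3, §2.1, §2.3.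
* [Milnor1968] J. Milnor, Singular Points of Complex Hypersurfaces, §9 Thm. 9.1, Lemma 9.4, p. 77.
* [VoisinHodgeII2003] C. Voisin, Hodge Theory and Complex Algebraic Geometry II (2003), §2.3, §3.2.1.
-/

noncomputable section

open CategoryTheory AlgebraicGeometry MvPolynomial TopologicalSpace Set Topology Filter Complex
open scoped Manifold ContDiff Real unitInterval
open Literature.AlgebraicGeometry.Motives Literature.AlgebraicGeometry.Motives.UniversalHypersurface
open Literature.AlgebraicGeometry.HodgeTheory.UniversalHypersurface Literature.Geometry.ComplexAnalytic Literature.Geometry.Manifold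
open Literature.AlgebraicTopology.SingularHomology

namespace Literature.AlgebraicGeometry.HodgeTheory

namespace WeightedPencil

/-- **The weighted rotations `R_{±2π} : zⱼ ↦ e^{±2πi/aⱼ} zⱼ` of the Pham–Brieskorn fibre `{Σ zⱼ^{aⱼ} = 1}`** (all `aⱼ ≠ 0`) as
continuous self-maps, with `R_{−2π} ∘ R_{2π} = id` (Milnor's characteristic homeomorphism `h = r_{a₀} ⊗ ⋯ ⊗ r_{aₙ}` of the fibre and
its inverse). [cite: Milnor1968, §9 Lemma 9.4 and p. 77] [cite: ArnoldGuseinzadeVarchenko2012, Part I §2.3] -/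
theorem exists_weightedRotation_fibre {n : ℕ} (a : Fin (n + 1) → ℕ) (ha : ∀ j, a j ≠ 0) :
    ∃ W g : C(↥(PhamBrieskorn.fibre a), ↥(PhamBrieskorn.fibre a)),
      (∀ z, ((W z : ↥(PhamBrieskorn.fibre a)) : Fin (n + 1) → ℂ) =
        fun j => Complex.exp ((((2 * π) / a j : ℝ) : ℂ) * Complex.I) * (z : Fin (n + 1) → ℂ) j) ∧
      (∀ z, ((g z : ↥(PhamBrieskorn.fibre a)) : Fin (n + 1) → ℂ) =
        fun j => Complex.exp ((((-(2 * π)) / a j : ℝ) : ℂ) * Complex.I) * (z : Fin (n + 1) → ℂ) j) ∧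
      g.comp W = ContinuousMap.id _ := by
  -- a rotation by `θ ∈ 2πℤ` preserves the fibre
  have hmem : ∀ θ : ℝ, Complex.exp ((θ : ℂ) * Complex.I) = 1 → ∀ z : ↥(PhamBrieskorn.fibre a),
      (fun j => Complex.exp (((θ / a j : ℝ) : ℂ) * Complex.I) * (z : Fin (n + 1) → ℂ) j) ∈ PhamBrieskorn.fibre a := by
    intro θ hθ z
    have hz := PhamBrieskorn.mem_fibre.mp z.2
    rw [PhamBrieskorn.mem_fibre, PhamBrieskorn.sum_pow_weightedRotation a ha θ, hz, hθ, one_mul]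
  have hcont : ∀ θ : ℝ, Continuous fun z : ↥(PhamBrieskorn.fibre a) =>
      (fun j => Complex.exp (((θ / a j : ℝ) : ℂ) * Complex.I) * (z : Fin (n + 1) → ℂ) j) := fun θ =>
    continuous_pi fun j => continuous_const.mul ((continuous_apply j).comp continuous_subtype_val)
  have h2π : Complex.exp (((2 * π : ℝ) : ℂ) * Complex.I) = 1 := by
    rw [show (((2 * π : ℝ)) : ℂ) * Complex.I = 2 * π * Complex.I by push_cast; ring]
    exact Complex.exp_two_pi_mul_I
  have h2π' : Complex.exp (((-(2 * π) : ℝ) : ℂ) * Complex.I) = 1 := by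
    rw [show (((-(2 * π) : ℝ)) : ℂ) * Complex.I = -(2 * π * Complex.I) by push_cast; ring, Complex.exp_neg,
      Complex.exp_two_pi_mul_I, inv_one]
  refine ⟨⟨fun z => ⟨_, hmem (2 * π) h2π z⟩, (hcont (2 * π)).subtype_mk _⟩,
    ⟨fun z => ⟨_, hmem (-(2 * π)) h2π' z⟩, (hcont (-(2 * π))).subtype_mk _⟩, fun z => rfl, fun z => rfl, ?_⟩
  refine ContinuousMap.ext fun z => Subtype.ext (funext fun j => ?_)
  change Complex.exp ((((-(2 * π)) / a j : ℝ) : ℂ) * Complex.I) *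
      (Complex.exp ((((2 * π) / a j : ℝ) : ℂ) * Complex.I) * (z : Fin (n + 1) → ℂ) j) = (z : Fin (n + 1) → ℂ) j
  rw [← mul_assoc, ← Complex.exp_add]
  push_cast
  rw [show -(2 * (π : ℂ)) / (a j : ℂ) * Complex.I + 2 * π / (a j : ℂ) * Complex.I = 0 by ring, Complex.exp_zero, one_mul]

section Localisation

variable {n d : ℕ} {i : Fin (n + 2)} (a : Fin (n + 1) → ℕ) (ha : ∀ j, a j ≠ 0) (hd : 0 < d) (b₀ : DegIndex n d → ℂ)
  (Φ : OpenPartialHomeomorph (ComplexPoints (regularTotal ℂ n d)) (({m : DegIndex n d // m ≠ regPowIndex n d i} ⊕ Fin (n + 1)) → ℂ))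
  (hΦ : ⇑Φ = regChartFun n d i) (hΦs : Φ.source = regChartDom n d i) (hΦt : Φ.target = regChartFun n d i '' regChartDom n d i)
  (Θ : OpenPartialHomeomorph (Fin (n + 1) → ℂ) (Fin (n + 1) → ℂ)) {r R''' R'' : ℝ}
  (hr : {z : Fin (n + 1) → ℂ | ∑ j, ‖z j‖ ^ 2 ≤ r ^ 2} ⊆ Θ.target)
  (hΘ : ContDiffOn ℝ ∞ Θ Θ.source) (hR'' : {z : Fin (n + 1) → ℂ | ∑ j, ‖z j‖ ^ 2 ≤ R''} ⊆ Θ.target)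
  (φ : (Fin (n + 1) → ℂ) → ℂ)
  (hφ : ∀ y, φ y = regChartCoeffVec n d i
    (Sum.elim (fun m : {m : DegIndex n d // m ≠ regPowIndex n d i} => b₀ m.1) y) (regPowIndex n d i) - b₀ (regPowIndex n d i))
  (hΘφ : ∀ y ∈ Θ.source, ∑ j, (Θ y j) ^ a j = φ y)
  {ρW : ℝ}
  (hns : ∀ c : ℂ, c ≠ 0 → ‖c‖ < ρW →
    SmoothHypersurface.IsNonsingularForm ℂ (formOfCoeffs (b₀ + Pi.single (regPowIndex n d i) c)))
  (hR : R''' < R'') {t₂ T' T δ₀ : ℝ} (hTR : T ≤ R''') (hTr : T ≤ r ^ 2) (ht₂T' : t₂ < T') (hT'T : T' < T) (hδρ : δ₀ ≤ ρW)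
  -- the time-one monodromy map, its inverse and its homotopy to the model (outputs of `exists_pencil_monodromyMap` at `u = 1`)
  (h₁ k₁ : NodalPencil.pencilSlice n d i b₀ → NodalPencil.pencilSlice n d i b₀)
  (hh₁c : Continuous fun x : {x : NodalPencil.pencilSlice n d i b₀ // NodalPencil.pencilCoord n d i b₀ x.1 ≠ 0} => h₁ x.1)
  (hh₁pc : ∀ x, NodalPencil.pencilCoord n d i b₀ x.1 ≠ 0 → ‖NodalPencil.pencilCoord n d i b₀ x.1‖ < δ₀ →
    NodalPencil.pencilCoord n d i b₀ (h₁ x).1 = NodalPencil.pencilCoord n d i b₀ x.1)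
  (hh₁F : ∀ x, NodalPencil.pencilCoord n d i b₀ x.1 ≠ 0 → ‖NodalPencil.pencilCoord n d i b₀ x.1‖ < δ₀ → NodalPencil.satRadius n d i Θ R''' R'' x.1 < T →
    NodalPencil.satRadius n d i Θ R''' R'' (h₁ x).1 = NodalPencil.satRadius n d i Θ R''' R'' x.1)
  (hh₁id : ∀ x, NodalPencil.pencilCoord n d i b₀ x.1 ≠ 0 → ‖NodalPencil.pencilCoord n d i b₀ x.1‖ < δ₀ → t₂ ≤ NodalPencil.satRadius n d i Θ R''' R'' x.1 → h₁ x = x)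
  (hk₁h₁ : ∀ x, NodalPencil.pencilCoord n d i b₀ x.1 ≠ 0 → ‖NodalPencil.pencilCoord n d i b₀ x.1‖ < δ₀ → k₁ (h₁ x) = x)
  (hh₁k₁ : ∀ x, NodalPencil.pencilCoord n d i b₀ x.1 ≠ 0 → ‖NodalPencil.pencilCoord n d i b₀ x.1‖ < δ₀ → h₁ (k₁ x) = x)
  (hk₁pc : ∀ x, NodalPencil.pencilCoord n d i b₀ x.1 ≠ 0 → ‖NodalPencil.pencilCoord n d i b₀ x.1‖ < δ₀ →
    NodalPencil.pencilCoord n d i b₀ (k₁ x).1 = NodalPencil.pencilCoord n d i b₀ x.1)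
  (H : ℝ × NodalPencil.pencilSlice n d i b₀ → NodalPencil.pencilSlice n d i b₀)
  (hHc : ContinuousOn H (univ ×ˢ {x : NodalPencil.pencilSlice n d i b₀ |
    NodalPencil.satRadius n d i Θ R''' R'' x.1 < T ∧ NodalPencil.pencilCoord n d i b₀ x.1 ≠ 0 ∧ ‖NodalPencil.pencilCoord n d i b₀ x.1‖ < δ₀}))
  (hH : ∀ s x, NodalPencil.pencilCoord n d i b₀ x.1 ≠ 0 → ‖NodalPencil.pencilCoord n d i b₀ x.1‖ < δ₀ → NodalPencil.satRadius n d i Θ R''' R'' x.1 < T →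
    NodalPencil.pencilCoord n d i b₀ (H (s, x)).1 = NodalPencil.pencilCoord n d i b₀ x.1 ∧
    NodalPencil.satRadius n d i Θ R''' R'' (H (s, x)).1 = NodalPencil.satRadius n d i Θ R''' R'' x.1 ∧
    (H (0, x)).1 = chartModelIsotopy a Φ Θ (2 * π) x.1 ∧
    (NodalPencil.satRadius n d i Θ R''' R'' x.1 ≤ T' → H (1, x) = h₁ x))
  -- the member
  {c : ℂ} (hc0 : c ≠ 0) (hcδ : ‖c‖ < δ₀) (hXc : IsCompact (NodalPencil.pencilFibre n d i b₀ c))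
  (lam : Fin (n + 1) → ℂ) (hlam : ∀ j, lam j ^ a j = c) (hlamT : ∑ j, ‖lam j‖ ^ 2 < T')
include ha hd hΦ hΦs hΦt hr hΘ hR'' hφ hΘφ hns hR hTR hTr ht₂T' hT'T hδρ hh₁c hh₁pc hh₁F hh₁id hk₁h₁ hh₁k₁ hk₁pc hHc hH hc0 hcδ hXc
  hlam hlamT

/-- **The localisation datum on the member `X_c`** (weights `a`). With `A = X_c ∩ {F < T'}`: a continuous self-map `κ` of `X_c`
reading the inverse time-one monodromy map `k₁`, equal to the identity where `F > t₂` and preserving `A` (restriction `κA`); the local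
Milnor fibre chart `e : A → {Σ zⱼ^{aⱼ} = 1}`, bijective on every `H_k(·; M)`; the inverse weighted rotation `g = R_{−2π}`; and the homotopy
`e ∘ κA ≃ g ∘ e`. [cite: ArnoldGuseinzadeVarchenko2012, Part I §1.3, §2.1 and §2.3] [cite: Milnor1968, §9 Thm. 9.1 and Lemma 9.4]
[cite: VoisinHodgeII2003, §3.2.1] -/
theorem exists_localisation_pencilFibre :
    ∃ (κ : C(↥(NodalPencil.pencilFibre n d i b₀ c), ↥(NodalPencil.pencilFibre n d i b₀ c)))
      (κA : C(↥{Q : ↥(NodalPencil.pencilFibre n d i b₀ c) | NodalPencil.satRadius n d i Θ R''' R'' Q.1 < T'},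
        ↥{Q : ↥(NodalPencil.pencilFibre n d i b₀ c) | NodalPencil.satRadius n d i Θ R''' R'' Q.1 < T'}))
      (e : C(↥{Q : ↥(NodalPencil.pencilFibre n d i b₀ c) | NodalPencil.satRadius n d i Θ R''' R'' Q.1 < T'},
        ↥(PhamBrieskorn.fibre a)))
      (g : C(↥(PhamBrieskorn.fibre a), ↥(PhamBrieskorn.fibre a))),
      (∀ y, ((κ y : ↥(NodalPencil.pencilFibre n d i b₀ c)) : ComplexPoints (regularTotal ℂ n d)) = (k₁ ⟨y.1, y.2.1⟩).1) ∧
      (∀ y : ↥(NodalPencil.pencilFibre n d i b₀ c), t₂ < NodalPencil.satRadius n d i Θ R''' R'' y.1 → κ y = y) ∧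
      (∀ a, ((κA a : ↥{Q : ↥(NodalPencil.pencilFibre n d i b₀ c) | NodalPencil.satRadius n d i Θ R''' R'' Q.1 < T'}) : ↥(NodalPencil.pencilFibre n d i b₀ c)) =
        κ a.1) ∧
      (∀ (R M : Type) [CommRing R] [AddCommGroup M] [Module R M] (k' : ℕ),
        Function.Bijective (singularHomology.map R M e k').hom) ∧
      (∀ z, ((g z : ↥(PhamBrieskorn.fibre a)) : Fin (n + 1) → ℂ) =
        fun j => Complex.exp ((((-(2 * π)) / a j : ℝ) : ℂ) * Complex.I) * (z : Fin (n + 1) → ℂ) j) ∧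
      (e.comp κA).Homotopic (g.comp e) := by
  haveI : T2Space (ComplexPoints (regularTotal ℂ n d)) := t2Space_regularTotal n d
  haveI : CompactSpace ↥(NodalPencil.pencilFibre n d i b₀ c) := isCompact_iff_compactSpace.mp hXc
  have hcρ : ‖c‖ < ρW := lt_of_lt_of_le hcδ hδρ
  have hT'R : T' ≤ R''' := hT'T.le.trans hTR
  have hT'r : T' ≤ r ^ 2 := hT'T.le.trans hTr
  set X := NodalPencil.pencilFibre n d i b₀ c with hX_def
  -- points of `X_c` as good points of the slice
  have hgoodc : ∀ y : ↥X, NodalPencil.pencilCoord n d i b₀ y.1 ≠ 0 ∧ ‖NodalPencil.pencilCoord n d i b₀ y.1‖ < δ₀ := fun y => by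
    rw [y.2.2]; exact ⟨hc0, hcδ⟩
  -- the restriction `hY` of `h₁` to `X_c`, a homeomorphism with inverse reading `k₁`
  let toS : ↥X → {x : NodalPencil.pencilSlice n d i b₀ // NodalPencil.pencilCoord n d i b₀ x.1 ≠ 0} := fun y => ⟨⟨y.1, y.2.1⟩, (hgoodc y).1⟩
  have htoS : Continuous toS := (continuous_subtype_val.subtype_mk _).subtype_mk _
  have hmemY : ∀ y : ↥X, (h₁ ⟨y.1, y.2.1⟩).1 ∈ X := fun y =>
    ⟨(h₁ ⟨y.1, y.2.1⟩).2, by rw [hh₁pc ⟨y.1, y.2.1⟩ (hgoodc y).1 (hgoodc y).2]; exact y.2.2⟩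
  have hmemK : ∀ y : ↥X, (k₁ ⟨y.1, y.2.1⟩).1 ∈ X := fun y =>
    ⟨(k₁ ⟨y.1, y.2.1⟩).2, by rw [hk₁pc ⟨y.1, y.2.1⟩ (hgoodc y).1 (hgoodc y).2]; exact y.2.2⟩
  let hY : C(↥X, ↥X) := ⟨fun y => ⟨(h₁ ⟨y.1, y.2.1⟩).1, hmemY y⟩, (continuous_subtype_val.comp (hh₁c.comp htoS)).subtype_mk _⟩
  have hYval : ∀ y, ((hY y : ↥X) : ComplexPoints (regularTotal ℂ n d)) = (h₁ ⟨y.1, y.2.1⟩).1 := fun y => rfl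
  let kY : ↥X → ↥X := fun y => ⟨(k₁ ⟨y.1, y.2.1⟩).1, hmemK y⟩
  have hkYval : ∀ y, ((kY y : ↥X) : ComplexPoints (regularTotal ℂ n d)) = (k₁ ⟨y.1, y.2.1⟩).1 := fun y => rfl
  have hkh : ∀ y, kY (hY y) = y := fun y => by
    apply Subtype.ext
    rw [hkYval]
    have h := hk₁h₁ ⟨y.1, y.2.1⟩ (hgoodc y).1 (hgoodc y).2
    have hmk : (⟨(hY y).1, (hY y).2.1⟩ : NodalPencil.pencilSlice n d i b₀) = h₁ ⟨y.1, y.2.1⟩ := Subtype.ext (hYval y)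
    rw [hmk, h]
  have hhk : ∀ y, hY (kY y) = y := fun y => by
    apply Subtype.ext
    rw [hYval]
    have h := hh₁k₁ ⟨y.1, y.2.1⟩ (hgoodc y).1 (hgoodc y).2
    have hmk : (⟨(kY y).1, (kY y).2.1⟩ : NodalPencil.pencilSlice n d i b₀) = k₁ ⟨y.1, y.2.1⟩ := Subtype.ext (hkYval y)
    rw [hmk, h]
  let hYe : ↥X ≃ ↥X := ⟨hY, kY, hkh, hhk⟩
  let hYh : ↥X ≃ₜ ↥X := Continuous.homeoOfEquivCompactToT2 (f := hYe) hY.continuous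
  let κ : C(↥X, ↥X) := (hYh.symm : C(↥X, ↥X))
  have hκ : ∀ y, κ y = kY y := fun y => rfl
  -- the open cover `A = {F < T'}`, `B = {F > t₂}`
  have hFc : Continuous (NodalPencil.satRadius n d i Θ R''' R'') := NodalPencil.continuous_satRadius n d i Θ R''' R'' hd hΘ hR hR''
  set A : Set ↥X := {Q | NodalPencil.satRadius n d i Θ R''' R'' Q.1 < T'} with hA_def
  have hB : ∀ y : ↥X, t₂ < NodalPencil.satRadius n d i Θ R''' R'' y.1 → κ y = y := fun y hy => by
    have h1 : hY y = y := Subtype.ext (by rw [hYval, hh₁id ⟨y.1, y.2.1⟩ (hgoodc y).1 (hgoodc y).2 (le_of_lt hy)])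
    calc κ y = κ (hY y) := by rw [h1]
      _ = y := by rw [hκ]; exact hkh y
  have hAF : ∀ y : ↥A, NodalPencil.satRadius n d i Θ R''' R'' (hY y.1).1 < T' := fun y => by
    rw [hYval, hh₁F ⟨y.1.1, y.1.2.1⟩ (hgoodc y.1).1 (hgoodc y.1).2 (lt_trans y.2 hT'T)]; exact y.2
  have hAK : ∀ y : ↥A, NodalPencil.satRadius n d i Θ R''' R'' (κ y.1).1 < T' := fun y => by
    -- `F(k₁ y) = F(y)` since `F(y) < T` and `y = h₁ (k₁ y)`
    rw [hκ, hkYval]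
    have hyT : NodalPencil.satRadius n d i Θ R''' R'' y.1.1 < T := lt_trans y.2 hT'T
    -- apply `hh₁F` to `k₁ y`: need `F(k₁ y) < T`; argue by contradiction using `hh₁id`
    by_contra hnot
    have hge : T' ≤ NodalPencil.satRadius n d i Θ R''' R'' (k₁ ⟨y.1.1, y.1.2.1⟩).1 := not_lt.mp hnot
    have hk0 : NodalPencil.pencilCoord n d i b₀ (k₁ ⟨y.1.1, y.1.2.1⟩).1 ≠ 0 := by
      rw [hk₁pc ⟨y.1.1, y.1.2.1⟩ (hgoodc y.1).1 (hgoodc y.1).2]; exact (hgoodc y.1).1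
    have hkδ : ‖NodalPencil.pencilCoord n d i b₀ (k₁ ⟨y.1.1, y.1.2.1⟩).1‖ < δ₀ := by
      rw [hk₁pc ⟨y.1.1, y.1.2.1⟩ (hgoodc y.1).1 (hgoodc y.1).2]; exact (hgoodc y.1).2
    have hid := hh₁id (k₁ ⟨y.1.1, y.1.2.1⟩) hk0 hkδ (ht₂T'.le.trans hge)
    rw [hh₁k₁ ⟨y.1.1, y.1.2.1⟩ (hgoodc y.1).1 (hgoodc y.1).2] at hid
    have hF : NodalPencil.satRadius n d i Θ R''' R'' y.1.1 = NodalPencil.satRadius n d i Θ R''' R'' (k₁ ⟨y.1.1, y.1.2.1⟩).1 := by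
      rw [← hid]
    exact absurd (hF ▸ y.2) hnot
  let hA : C(↥A, ↥A) := ⟨fun y => ⟨hY y.1, hAF y⟩, (hY.continuous.comp continuous_subtype_val).subtype_mk _⟩
  let κA : C(↥A, ↥A) := ⟨fun y => ⟨κ y.1, hAK y⟩, (κ.continuous.comp continuous_subtype_val).subtype_mk _⟩
  have hhAκA : hA.comp κA = ContinuousMap.id _ := by
    refine ContinuousMap.ext fun y => Subtype.ext ?_
    change hY (κ y.1) = y.1
    rw [hκ, hhk]
  -- the local Milnor fibre chart
  obtain ⟨e, hbij, he⟩ := exists_localFibreChart a ha hd b₀ Φ hΦ hΦs hΦt Θ hr φ hφ hΘφ hns hR hT'R hT'r hc0 hcρ lam hlam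
    hΘ.continuousOn hlamT
  -- the weighted rotations `R_{2π}` (`W`) and `R_{-2π}` (`g`)
  obtain ⟨W, g, hW, hg, hgW⟩ := exists_weightedRotation_fibre a ha
  -- the homotopy `e ∘ H(s, ·)` on `A`
  have hD : ∀ y : ↥A, NodalPencil.satRadius n d i Θ R''' R'' y.1.1 < T ∧ NodalPencil.pencilCoord n d i b₀ y.1.1 ≠ 0 ∧
      ‖NodalPencil.pencilCoord n d i b₀ y.1.1‖ < δ₀ := fun y =>
    ⟨lt_trans y.2 hT'T, (hgoodc y.1).1, (hgoodc y.1).2⟩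
  have hHmem : ∀ (s : ℝ) (y : ↥A), (H (s, ⟨y.1.1, y.1.2.1⟩)).1 ∈ X ∧
      NodalPencil.satRadius n d i Θ R''' R'' (H (s, ⟨y.1.1, y.1.2.1⟩)).1 < T' := fun s y => by
    obtain ⟨hpc, hF, -, -⟩ := hH s ⟨y.1.1, y.1.2.1⟩ (hD y).2.1 (hD y).2.2 (hD y).1
    exact ⟨⟨(H (s, ⟨y.1.1, y.1.2.1⟩)).2, by rw [hpc]; exact y.1.2.2⟩, by rw [hF]; exact y.2⟩
  let pt : ℝ × ↥A → ↥A := fun sy => ⟨⟨(H (sy.1, ⟨sy.2.1.1, sy.2.1.2.1⟩)).1, (hHmem sy.1 sy.2).1⟩, (hHmem sy.1 sy.2).2⟩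
  have hptc : Continuous pt := by
    refine Continuous.subtype_mk (Continuous.subtype_mk ?_ _) _
    have hin : Continuous fun sy : ℝ × ↥A => ((sy.1, ⟨sy.2.1.1, sy.2.1.2.1⟩) : ℝ × NodalPencil.pencilSlice n d i b₀) :=
      continuous_fst.prodMk ((continuous_subtype_val.comp (continuous_subtype_val.comp continuous_snd)).subtype_mk _)
    exact continuous_subtype_val.comp (hHc.comp_continuous hin fun sy => ⟨mem_univ _, hD sy.2⟩)
  let G : C(I × ↥A, ↥(PhamBrieskorn.fibre a)) :=
    ⟨fun sy => e (pt (sy.1, sy.2)), e.continuous.comp (hptc.comp ((continuous_subtype_val.comp continuous_fst).prodMk continuous_snd))⟩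
  -- `G(0, ·) = W ∘ e`
  have hG0 : ∀ y : ↥A, G (0, y) = W (e y) := by
    intro y
    obtain ⟨-, -, hH0, -⟩ := hH 0 ⟨y.1.1, y.1.2.1⟩ (hD y).2.1 (hD y).2.2 (hD y).1
    obtain ⟨hx, hyΘ, hyr, -⟩ := monodromyMap_good a ha hd b₀ Φ hΦ hΦs hΦt Θ hr φ hφ hΘφ hns hR hTR hTr y.1.2.1 (hD y).1 (hD y).2.1
      (lt_of_lt_of_le (hD y).2.2 hδρ)
    have haff := affine_chartModelIsotopy a ha hd b₀ Φ hΦ hΦs hΦt Θ hr φ hφ hΘφ hns hx y.1.2.1 hyΘ hyr (hD y).2.1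
      (lt_of_lt_of_le (hD y).2.2 hδρ) (2 * π)
    obtain ⟨-, happ, -⟩ := PhamBrieskorn.modelIsotopy_mem a Θ hr hyr (2 * π)
    apply Subtype.ext
    change (e (pt ((0 : I), y)) : Fin (n + 1) → ℂ) = (W (e y) : Fin (n + 1) → ℂ)
    rw [he, hW, he]
    change (fun j => Θ (fun j => regChartFun n d i (H ((0 : ℝ), ⟨y.1.1, y.1.2.1⟩)).1 (Sum.inr j)) j / lam j) = _
    rw [hH0, haff]
    rw [happ]
    funext j
    simp only [mul_div_assoc]
  -- `G(1, ·) = e ∘ hA`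
  have hG1 : ∀ y : ↥A, G (1, y) = e (hA y) := by
    intro y
    obtain ⟨-, -, -, hH1⟩ := hH 1 ⟨y.1.1, y.1.2.1⟩ (hD y).2.1 (hD y).2.2 (hD y).1
    change e (pt ((1 : ℝ), y)) = e (hA y)
    congr 1
    apply Subtype.ext; apply Subtype.ext
    change (H ((1 : ℝ), ⟨y.1.1, y.1.2.1⟩)).1 = (h₁ ⟨y.1.1, y.1.2.1⟩).1
    rw [hH1 (le_of_lt y.2)]
  have hconj₁ : (e.comp hA).Homotopic (W.comp e) :=
    ⟨{ toContinuousMap := G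
       map_zero_left := fun y => by rw [ContinuousMap.comp_apply]; exact hG0 y
       map_one_left := fun y => by rw [ContinuousMap.comp_apply]; exact hG1 y :
        ContinuousMap.Homotopy (W.comp e) (e.comp hA) }.symm⟩
  -- transfer to the inverse: `e ∘ κA ≃ g ∘ e`, `g = R_{-2π} = W⁻¹`
  have hconj : (e.comp κA).Homotopic (g.comp e) := by
    -- `e = (e ∘ hA) ∘ κA ≃ (W ∘ e) ∘ κA`, then apply `g`: `g ∘ e ≃ g ∘ W ∘ e ∘ κA = e ∘ κA`
    have h2 : ((e.comp hA).comp κA).Homotopic ((W.comp e).comp κA) := hconj₁.comp (ContinuousMap.Homotopic.refl κA)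
    have he' : (e.comp hA).comp κA = e := by rw [ContinuousMap.comp_assoc, hhAκA, ContinuousMap.comp_id]
    rw [he'] at h2
    have h3 : (g.comp e).Homotopic (g.comp ((W.comp e).comp κA)) := (ContinuousMap.Homotopic.refl g).comp h2
    have hgg' : g.comp ((W.comp e).comp κA) = e.comp κA := by
      rw [ContinuousMap.comp_assoc, ← ContinuousMap.comp_assoc g W, hgW, ContinuousMap.id_comp]
    rw [hgg'] at h3
    exact h3.symm
  refine ⟨κ, κA, e, g, fun y => by rw [hκ], hB, fun a => rfl, hbij, hg, hconj⟩

end Localisation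

end WeightedPencil

end Literature.AlgebraicGeometry.HodgeTheory

end
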